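import Summits.KontsevichZagierPeriods.KontsevichZagierPeriods.Theses.HurwitzMicroSectors
import Summits.KontsevichZagierPeriods.KontsevichZagierPeriods.Theorems.HurwitzMicroSectorsNormalFormPrinciplePiBoxTransfer
import Summits.KontsevichZagierPeriods.KontsevichZagierPeriods.Theorems.HurwitzMicroSectorsNormalFormPrincipleVariants2313
import Summits.KontsevichZagierPeriods.KontsevichZagierPeriods.Theorems.HurwitzMicroSectorsNormalFormPrincipleVariants2305

/-! TTRL-lite variant V2314 of stmt-KontsevichZagierPeriods-3869

Variant V2314 = `stub_boxRigidity` (the leaf `BoxRigidity` of `NormalFormPrinciple`: two representations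
on open unit boxes with integrands of KZ's rational shape `p/q` over `ℚ` and equal values are
KZ-equivalent) under the move `fix_nat:m=6; bound_nat:m'≤6` (left dimension frozen to `6`, right
dimension bounded by `6`). Verdict of the attempt seat: **open** — this file is the exact-strength
certificate, not a proof of the variant. Writing `BoxVanishing K` for "a box-rational representation of
dimension `K` and value `0` is a relation": V2314 is literally the same statement as the diagonal sibling
V2313 (pair `(6, 6)`; `stub_boxRigidity_var2314_iff_var2313`: specialise `m' := 6` one way, pad the
`m'`-box to the `6`-box the other way), hence exactly `BoxVanishing 6`
(`stub_boxRigidity_var2314_iff_boxVanishing_six`), exactly the two-sided bounded leaf `BoxRigidity(m, m' ≤ 6)`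
(`…_iff_le_six`) and exactly the sibling V2305 (`fix_nat:m=6; bound_nat:m'≤3`, `…_iff_var2305`) — so
relaxing the bound on `m'` from `3` (V2305) or `2` (V2302) to `6` changes nothing. Downward it gives
`BoxVanishing j` for every `j ≤ 6` (`boxVanishing_le_six_of_stub_boxRigidity_var2314`); from above it is
implied by `BoxVanishing 6` alone, by the parent leaf and by the Summit (`…_of_boxVanishing_six`,
`…_of_parent`, `…_of_statement`). Why open: `BoxVanishing 6 ⊇ BoxVanishing 5 ∋` "for `a b : ℚ`,
`a + b·ζ(5) = 0 ⇒ [a + b/(1 − x₁⋯x₅)]_{(0,1)⁵}` is a relation" (today only via `ζ(5) ∉ ℚ`, open),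
`⊇ BoxVanishing 3 ∋` the case split `ζ(3) ∈ ℚ + ℚπ²`, `⊇ BoxVanishing 2 ∋` Catalan's dichotomy; the tree
proves `BoxVanishing ≤ 1` only (Baker). Conversely a refutation of V2314 refutes `KontsevichZagierPeriods`
(`…_of_statement`), and the tree has no additive invariant of `KZ.relations` finer than `KZ.eval`
(`IntegralRep` carries `integrableOn`, so there is no junk-integral loophole either).
Source: M. Kontsevich, D. Zagier, *Periods* (2001), §1.2 Conjecture 1 and rules 1)–3). Pure proof file,
no definitions. -/

-- `Summit.<Summit>.<Problem>` is the tree's mandated summit-side namespace (CONVENTIONS §2); for this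
-- single-conjunct summit the two coincide, so the duplicate is deliberate.
set_option linter.dupNamespace false

noncomputable section

namespace Summit.KontsevichZagierPeriods.KontsevichZagierPeriods.Theorems

open MeasureTheory Set
open Literature.NumberTheory.Transcendental Literature.NumberTheory.Transcendental.KZ
open Summit.KontsevichZagierPeriods.KontsevichZagierPeriods.Theses.HurwitzMicroSectors
open Summit.KontsevichZagierPeriods.HurwitzMicroSectors.NormalFormPrinciple.PiBox

/-! ## The variant V2314 itself: the diagonal sibling V2313, i.e. exactly `BoxVanishing 6` -/

/-- **V2314 ⟺ the sibling V2313** (`fix_nat:m=6; fix_nat:m'=6`): (⇒) specialise `m' := 6`; (⇐) V2313 is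
the bounded leaf `BoxRigidity(m, m' ≤ 6)` (`stub_boxRigidity_var2313_iff_le_six`, padding), take `m := 6`.
[cite: KontsevichZagier2001, §1.2 Conjecture 1] -/
theorem stub_boxRigidity_var2314_iff_var2313 :
    (∀ (m' : ℕ) (N : IntegralRep 6) (N' : IntegralRep m'), m' ≤ 6 → N.domain = {x | ∀ i, x i ∈ Set.Ioo (0:ℝ) 1} → N.IsRational → N'.domain = {x | ∀ i, x i ∈ Set.Ioo (0:ℝ) 1} → N'.IsRational → N.value = N'.value → Equivalent N N') ↔
    (∀ (N : IntegralRep 6) (N' : IntegralRep 6), N.domain = {x | ∀ i, x i ∈ Set.Ioo (0:ℝ) 1} →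
      N.IsRational → N'.domain = {x | ∀ i, x i ∈ Set.Ioo (0:ℝ) 1} → N'.IsRational →
      N.value = N'.value → Equivalent N N') :=
  ⟨fun h N N' => h 6 N N' le_rfl,
    fun h m' N N' hm' => stub_boxRigidity_var2313_iff_le_six.1 h 6 m' N N' le_rfl hm'⟩

/-- **V2314 ⟺ `BoxVanishing 6`**: a box-rational representation on the `6`-box of value `0` is a
relation (through V2313, the instance `max 6 6 = 6` of `boxRigidityPair_iff_boxVanishingDim`).
[cite: KontsevichZagier2001, §1.2 Conjecture 1] -/
theorem stub_boxRigidity_var2314_iff_boxVanishing_six :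
    (∀ (m' : ℕ) (N : IntegralRep 6) (N' : IntegralRep m'), m' ≤ 6 → N.domain = {x | ∀ i, x i ∈ Set.Ioo (0:ℝ) 1} → N.IsRational → N'.domain = {x | ∀ i, x i ∈ Set.Ioo (0:ℝ) 1} → N'.IsRational → N.value = N'.value → Equivalent N N') ↔
    (∀ (M : IntegralRep 6), M.domain = {x | ∀ i, x i ∈ Set.Ioo (0:ℝ) 1} →
      M.IsRational → M.value = 0 → of M ∈ relations) := by
  rw [stub_boxRigidity_var2314_iff_var2313]
  exact stub_boxRigidity_var2313_iff_boxVanishing_six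

/-- **V2314 ⟺ the two-sided bounded leaf `BoxRigidity(m, m' ≤ 6)`** (the honest strength of the
variant: Conjecture 1 for all pairs of rational integrands on the open unit boxes of dimension at most
`6` — among these periods `π²`, `π⁴`, `π⁶`, `ζ(3)`, `ζ(5)`, `ζ(3)²`, Catalan's `G` and every multiple zeta
value of weight `≤ 6`; freezing the left dimension to `6` loses nothing, by padding).
[cite: KontsevichZagier2001, §1.2 Conjecture 1] -/
theorem stub_boxRigidity_var2314_iff_le_six :
    (∀ (m' : ℕ) (N : IntegralRep 6) (N' : IntegralRep m'), m' ≤ 6 → N.domain = {x | ∀ i, x i ∈ Set.Ioo (0:ℝ) 1} → N.IsRational → N'.domain = {x | ∀ i, x i ∈ Set.Ioo (0:ℝ) 1} → N'.IsRational → N.value = N'.value → Equivalent N N') ↔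
    (∀ (m m' : ℕ) (N : IntegralRep m) (N' : IntegralRep m'), m ≤ 6 → m' ≤ 6 →
      N.domain = {x | ∀ i, x i ∈ Set.Ioo (0:ℝ) 1} → N.IsRational →
      N'.domain = {x | ∀ i, x i ∈ Set.Ioo (0:ℝ) 1} → N'.IsRational →
      N.value = N'.value → Equivalent N N') := by
  rw [stub_boxRigidity_var2314_iff_var2313]
  exact stub_boxRigidity_var2313_iff_le_six

/-- **V2314 ⟺ the sibling V2305** (`fix_nat:m=6; bound_nat:m'≤3`): both are `BoxVanishing 6`
(`stub_boxRigidity_var2305_iff_boxVanishing_six`), so the relaxed bound `m' ≤ 6` adds nothing to `m' ≤ 3`.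
[cite: KontsevichZagier2001, §1.2 Conjecture 1] -/
theorem stub_boxRigidity_var2314_iff_var2305 :
    (∀ (m' : ℕ) (N : IntegralRep 6) (N' : IntegralRep m'), m' ≤ 6 → N.domain = {x | ∀ i, x i ∈ Set.Ioo (0:ℝ) 1} → N.IsRational → N'.domain = {x | ∀ i, x i ∈ Set.Ioo (0:ℝ) 1} → N'.IsRational → N.value = N'.value → Equivalent N N') ↔
    (∀ (m' : ℕ) (N : IntegralRep 6) (N' : IntegralRep m'), m' ≤ 3 → N.domain = {x | ∀ i, x i ∈ Set.Ioo (0:ℝ) 1} →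
      N.IsRational → N'.domain = {x | ∀ i, x i ∈ Set.Ioo (0:ℝ) 1} → N'.IsRational →
      N.value = N'.value → Equivalent N N') := by
  rw [stub_boxRigidity_var2314_iff_boxVanishing_six, stub_boxRigidity_var2305_iff_boxVanishing_six]

/-! ## Consequences downward, and the variant from above -/

/-- **V2314 ⇒ `BoxVanishing` in every dimension `j ≤ 6`** (pad to `(0,1)⁶`; the value is unchanged by
soundness): in particular the dimension-`5` statement containing the `ζ(5)` dichotomy, the dimension-`3`
one (`ζ(3)`, `π³`) and the dimension-`2` one containing Catalan's. [cite: KontsevichZagier2001, §1.2 Conjecture 1] -/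
theorem boxVanishing_le_six_of_stub_boxRigidity_var2314
    (h : ∀ (m' : ℕ) (N : IntegralRep 6) (N' : IntegralRep m'), m' ≤ 6 → N.domain = {x | ∀ i, x i ∈ Set.Ioo (0:ℝ) 1} → N.IsRational → N'.domain = {x | ∀ i, x i ∈ Set.Ioo (0:ℝ) 1} → N'.IsRational → N.value = N'.value → Equivalent N N')
    {j : ℕ} (hj : j ≤ 6) (N : IntegralRep j) (hNd : N.domain = {x | ∀ i, x i ∈ Set.Ioo (0:ℝ) 1})
    (hNr : N.IsRational) (hv : N.value = 0) : of N ∈ relations :=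
  boxVanishing_le_six_of_stub_boxRigidity_var2313 (stub_boxRigidity_var2314_iff_var2313.1 h) hj N hNd
    hNr hv

/-- **`BoxVanishing 6` alone already proves V2314** (the honest residual of the variant: whoever
settles Conjecture 1 for vanishing box-rational periods of dimension `6` settles V2314, and conversely).
[cite: KontsevichZagier2001, §1.2 Conjecture 1] -/
theorem stub_boxRigidity_var2314_of_boxVanishing_six
    (hvan : ∀ (M : IntegralRep 6), M.domain = {x | ∀ i, x i ∈ Set.Ioo (0:ℝ) 1} → M.IsRational →
      M.value = 0 → of M ∈ relations) :
    ∀ (m' : ℕ) (N : IntegralRep 6) (N' : IntegralRep m'), m' ≤ 6 → N.domain = {x | ∀ i, x i ∈ Set.Ioo (0:ℝ) 1} → N.IsRational → N'.domain = {x | ∀ i, x i ∈ Set.Ioo (0:ℝ) 1} → N'.IsRational → N.value = N'.value → Equivalent N N' :=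
  stub_boxRigidity_var2314_iff_boxVanishing_six.2 hvan

/-- **The parent leaf ⇒ V2314** (specialisation `m := 6`, drop the bound; the converse is not
claimed — the parent is `BoxVanishing` in ALL dimensions). [cite: KontsevichZagier2001, §1.2 Conjecture 1] -/
theorem stub_boxRigidity_var2314_of_parent
    (h : ∀ (m m' : ℕ) (N : IntegralRep m) (N' : IntegralRep m'), N.domain = {x | ∀ i, x i ∈ Set.Ioo (0:ℝ) 1} → N.IsRational → N'.domain = {x | ∀ i, x i ∈ Set.Ioo (0:ℝ) 1} → N'.IsRational → N.value = N'.value → Equivalent N N') :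
    ∀ (m' : ℕ) (N : IntegralRep 6) (N' : IntegralRep m'), m' ≤ 6 → N.domain = {x | ∀ i, x i ∈ Set.Ioo (0:ℝ) 1} → N.IsRational → N'.domain = {x | ∀ i, x i ∈ Set.Ioo (0:ℝ) 1} → N'.IsRational → N.value = N'.value → Equivalent N N' :=
  fun m' N N' _ => h 6 m' N N'

/-- **`KontsevichZagierPeriods ⇒ V2314`**: the variant is a special case of Conjecture 1 for the
tree's calculus (`leaves_of_statement`) — so a refutation of the variant would refute the Summit.
[cite: KontsevichZagier2001, §1.2 Conjecture 1] -/
theorem stub_boxRigidity_var2314_of_statement (h : _root_.KontsevichZagierPeriods) :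
    ∀ (m' : ℕ) (N : IntegralRep 6) (N' : IntegralRep m'), m' ≤ 6 → N.domain = {x | ∀ i, x i ∈ Set.Ioo (0:ℝ) 1} → N.IsRational → N'.domain = {x | ∀ i, x i ∈ Set.Ioo (0:ℝ) 1} → N'.IsRational → N.value = N'.value → Equivalent N N' :=
  stub_boxRigidity_var2314_of_parent (leaves_of_statement h).1

end Summit.KontsevichZagierPeriods.KontsevichZagierPeriods.Theorems

end
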